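import Summits.BirchSwinnertonDyer.BirchSwinnertonDyer.Theses.SignedLowerHalves
import Summits.BirchSwinnertonDyer.BirchSwinnertonDyer.Theorems.SignedLowerHalvesSmallImageMuZeroOneSignMuControl
import Summits.BirchSwinnertonDyer.BirchSwinnertonDyer.Theorems.SignedLowerHalvesSmallImageMuZeroOneSignFinePivotDichotomy
import Literature.NumberTheory.EllipticCurves.Kobayashi2003.SignedSelmerGeneratorChangeProofs
import Literature.NumberTheory.EllipticCurves.Kobayashi2003.SignedSelmerDualToFineDualProofs
import Literature.NumberTheory.EllipticCurves.Kato2004.FineSelmerDualInvolutionInvariantsProofs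
import Literature.NumberTheory.EllipticCurves.Kato2004.IwasawaInvolutionTwistProofs
import Literature.NumberTheory.EllipticCurves.SupersingularSelmerDualTorsionFineSelmer
import Literature.NumberTheory.EllipticCurves.Rank1Residual.MuLambdaCarriers
import Literature.NumberTheory.EllipticCurves.IwasawaNakayamaProofs
import Literature.NumberTheory.EllipticCurves.KatoRankBoundProofs
import HarnessLib
import Literature.NumberTheory.EllipticCurves.SupersingularSelmerDualExtensionOfFineDual

/-!
# Route `SignedLowerHalves` (K3), crux M `SmallImageMuZeroOneSign` (item stmt-BirchSwinnertonDyer-23600), line `birth_mu` —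
# the FINE PIVOT, part 3: the two Kurihara–Pollack inputs and THE LEVER at one cyclotomic datum
# (`Sel₀(ℚ_∞, E[p^∞])[p]` finite ⟹ `Sel⁺(E/ℚ_∞)[p]` or `Sel⁻(E/ℚ_∞)[p]` finite)

LEAD seat `cruxlead-stmt-BirchSwinnertonDyer-23600` gen 2 (cell `bsd-ssimc`; `--supports stmt-BirchSwinnertonDyer-23600`).  HONEST FRAMING:
CONDITIONAL theorems.  Binders displayed and never discharged: two PRINTED statements of Kurihara–Pollack 2007 stated here as named facts
(`def … : Prop`, §1, for relocation to `Literature/`; nothing asserted, no `_holds`) and the tree's Matar 2020 / Wingberg 1989 fact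
`matar2020_thm11_selmerDualTorsion_pseudoIso_fineSelmerDual`; plus, in the closers, Coates–Sujatha's CONJECTURE A on the crux's domain
(`Rank1Residual.ConjAAt W p`, OPEN) and — for the `p = 3` rows only — the five printed binders of line `birth_mu` (`hCK h12 h5 h3 hmodP`).
Crux M, crux 4 and BSD are NOT proved by this file; Conjecture A is asserted for no curve.

## The theorem (crux idea «fine-pivot-minsign», bsd-idea-5 g10, ADDENDUM v1.1 (B); kernel proof = parts 1–2 + this file)
For `E/ℚ`, `p` odd of good reduction with `a_p = 0`, over the cyclotomic `ℤ_p`-extension: if `Sel₀(ℚ_∞, E[p^∞])[p]` is finite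
(Conjecture A at the pair) then `Sel⁺(E/ℚ_∞)[p]` or `Sel⁻(E/ℚ_∞)[p]` is finite (`finite_signed_pTorsion_or`), hence for ONE sign `ε`
every Pontryagin dual datum of `Sel^ε(E/ℚ_∞)` over every cyclotomic datum has `μ = 0` (`oneSignMuZero_of_conjAAt`) — the body of
crux M at the pair.  Proof: inside the dual `X` of `S = Sel_{p^∞}(E/ℚ_∞) ⊇ Sel⁺, Sel⁻` (i) `ℓ_{(p)}(X/pX) ≤ 1` from Kurihara–Pollack's
extension `0 → Λ²/Λv → X → X₀ → 0` (p. 328: `H¹_glob ≅ Λ`, `H¹_loc ≅ Λ²`, Poitou–Tate) and `ℓ_{(p)}(tors X) = ℓ_{(p)}(X₀) = 0`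
(Wingberg Cor. 2.5 / Matar Thm. 1.1 + Conjecture A); (ii) `(Sel⁺ ∩ Sel⁻)[p]` is finite because `Sel⁺ ∩ Sel⁻ / Sel₀ ↪ E(ℚ_p) ⊗ ℚ_p/ℤ_p`
(Kurihara–Pollack p. 310: `C⁺ ∩ C⁻ = E(ℚ_p) ⊗ ℚ_p/ℤ_p`); (iii) the residual dichotomy of part 2.  The sign is moved across cyclotomic
data by `Kobayashi2003.exists_addEquiv_signedSelmerInfty_of_isCyclotomic`.

## Contents
* §1 named facts `kuriharaPollack2007_selmerDual_extension_of_fineDual`, `signedSelmerInf_sub_fineSelmer_of_loc`.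
* §2 `finite_signed_pTorsion_or` (the lever at one cyclotomic datum).  Part 4 (`…FinePivotOneSign.lean`) moves the sign to all
  cyclotomic data and concludes crux M BY NAME from Conjecture A on its domain.

References: [KuriharaPollack2007] §1.2 Prop. 1.2 (p. 310), §3 p. 328; [Kobayashi2003] Def. 1.1, Def. 2.1, Thm. 1.2, Thm. 7.3, p. 12,
Prop. 8.12; [Matar2020] Thm. 1.1; [Wingberg1989] Cor. 2.5; [CoatesSujatha2005] §3 Conjecture A, Thm. 3.4; [LeiSujatha2021] Thm. 1.2
(the same equivalence for the ANALYTIC `μ`, under Kato's main conjecture); [Kato2004Asterisque] Thm. 12.4.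
-/

set_option autoImplicit false
set_option linter.dupNamespace false

noncomputable section

open scoped Classical MatrixGroups ModularForm

namespace Summit.BirchSwinnertonDyer.BirchSwinnertonDyer.Theorems.SmallImageFinePivot

open Literature.NumberTheory.EllipticCurves Literature.NumberTheory.EllipticCurves.Module
  Literature.NumberTheory.EllipticCurves.IwasawaAlgebra Literature.NumberTheory.EllipticCurves.IwasawaDual

/-! ### §1 The two printed inputs (Kurihara–Pollack 2007), stated inline for relocation to `Literature/` -/

section Facts

open WeierstrassCurve Literature.NumberTheory.EllipticCurves.Kobayashi2003 ZpExtension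

end Facts

/-! ### §2 The lever at one cyclotomic datum: `Sel₀[p]` finite ⟹ `Sel⁺[p]` finite or `Sel⁻[p]` finite -/

section Lever

open WeierstrassCurve Literature.NumberTheory.EllipticCurves.Kobayashi2003
  Literature.NumberTheory.EllipticCurves.Kato2004 ZpExtension

variable {p : ℕ} [Fact p.Prime]

/-- The inclusion `Sel^ε ≤ Sel` intertwines `conj_γ − 1`. [cite: Kobayashi2003, Def. 1.1 (p. 2)] -/
theorem inclusion_signed_conj_sub_one (W : WeierstrassCurve ℚ) [W.IsElliptic] (κ : ZpExtension ℚ p) (ε : ℤˣ)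
    (γ : Field.absoluteGaloisGroup ℚ) (s : signedSelmerInfty W κ ε) :
    AddSubgroup.inclusion (signedSelmerInfty_le_selmerInfty W κ ε) ((conjSignedSelmerInfty W κ ε γ - 1) s) =
      (W.conjSelmerInfty κ γ - 1) (AddSubgroup.inclusion (signedSelmerInfty_le_selmerInfty W κ ε) s) := by
  apply Subtype.ext
  rw [AddSubgroup.coe_inclusion, IwasawaDual.End_sub_apply, IwasawaDual.End_sub_apply, AddMonoid.End.one_apply,
    AddMonoid.End.one_apply, AddSubgroupClass.coe_sub, AddSubgroupClass.coe_sub, coe_conjSignedSelmerInfty_apply,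
    coe_conjSelmerInfty_apply, AddSubgroup.coe_inclusion]

/-- `ℓ_{(p)}(X₀) = 0` for every fine dual datum at a topological generator once `Sel₀[p]` is finite (Conjecture A):
`X₀/(p)` finite ⟹ `X₀` finitely generated over `ℤ_p` ⟹ `(X₀)_{(p)} = 0`. [cite: Washington1997, §13.2]
[cite: GreenbergLNM1716, §1 p. 60] -/
theorem lengthAt_fineDual_eq_zero {W : WeierstrassCurve ℚ} [W.IsElliptic] {κ : ZpExtension ℚ p}
    {γ : Field.absoluteGaloisGroup ℚ} (hγ : κ.IsTopGenerator γ) (Y : W.FineSelmerDualData κ γ)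
    (hF : Set.Finite {s : W.fineSelmerInfty κ | p • s = 0})
    (𝔭 : PrimeSpectrum (IwasawaAlgebra p)) (h𝔭 : 𝔭.asIdeal = augIdealP p) :
    lengthAt (IwasawaAlgebra p) Y.X 𝔭 = 0 := by
  haveI : Module.Finite (IwasawaAlgebra p) Y.X := Y.module_finite_of_finite_pTorsion hγ hF
  have hfg := IwasawaModuleFinitePadicInt.moduleFinite_padicInt_of_finite_quotient_augIdealP p Y.X
    (Y.finite_quotient_augIdealP_of_finite_pTorsion hF)
  letI : Module ℤ_[p] Y.X := Module.compHom Y.X (algebraMap ℤ_[p] (IwasawaAlgebra p))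
  haveI : IsScalarTower ℤ_[p] (IwasawaAlgebra p) Y.X := IsScalarTower.of_compHom ℤ_[p] _ Y.X
  haveI : Module.Finite ℤ_[p] Y.X := hfg
  exact lengthAt_eq_zero_of_finite p Y.X 𝔭 h𝔭

/-- **`ℓ_{(p)}(tors X(E/ℚ_∞)) = 0` under Conjecture A** (at an odd good supersingular `p`): Matar 2020 Thm. 1.1 /
Wingberg Cor. 2.5 (`tors X ∼ X₀^ι`, tree fact `matar2020_thm11_…`) and `ℓ_{(p)}(X₀^ι) = ℓ_{(p)}(X₀) = 0`.
[cite: Matar2020, Thm. 1.1] [cite: Wingberg1989, Cor. 2.5] [cite: KuriharaPollack2007, §3 p. 328] -/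
theorem lengthAt_torsion_selmerDual_eq_zero (hMa : matar2020_thm11_selmerDualTorsion_pseudoIso_fineSelmerDual)
    {W : WeierstrassCurve ℚ} [W.IsElliptic] [W.IsGloballyMinimal] (hp : p ≠ 2) (hgood : W.HasGoodReductionAtPrime p)
    (hap : W.frobeniusTrace p = 0) {κ : ZpExtension ℚ p} {γ : Field.absoluteGaloisGroup ℚ} (hκ : κ.IsCyclotomic)
    (hγ : κ.IsTopGenerator γ) (S : W.SelmerDualData κ γ) (hF : Set.Finite {s : W.fineSelmerInfty κ | p • s = 0})
    (𝔭 : PrimeSpectrum (IwasawaAlgebra p)) (h𝔭 : 𝔭.asIdeal = augIdealP p) :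
    lengthAt (IwasawaAlgebra p) (Submodule.torsion (IwasawaAlgebra p) S.X) 𝔭 = 0 := by
  let Y := W.fineSelmerDualData κ hγ
  haveI : Module.Finite (IwasawaAlgebra p) Y.X := Y.module_finite_of_finite_pTorsion hγ hF
  have hYt : Module.IsTorsion (IwasawaAlgebra p) Y.X :=
    IwasawaModuleFinitePadicInt.isTorsion_of_finite_quotient_augIdealP p Y.X
      (Y.finite_quotient_augIdealP_of_finite_pTorsion hF)
  obtain ⟨Y', e, he, -⟩ := fineSelmerDualData_exists_involTwist (mul_inv_cancel γ) Y
  have hY't : Module.IsTorsion (IwasawaAlgebra p) Y'.X := isTorsion_of_involSemilinear hYt e he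
  obtain ⟨f, hf⟩ := hMa W p κ γ γ⁻¹ hp hgood (by rw [hap]; exact dvd_zero _) hκ hγ (mul_inv_cancel γ) S Y' hY't
  rw [Module.lengthAt_eq_of_isPseudoIsomorphism hf 𝔭 (by rw [h𝔭, height_augIdealP_holds p]),
    fineSelmerDualData_lengthAt_inv_eq_of_asIdeal_eq_augIdealP Y Y' 𝔭 h𝔭]
  exact lengthAt_fineDual_eq_zero hγ Y hF 𝔭 h𝔭

/-- **THE LEVER at one cyclotomic datum.** For `E/ℚ`, `p` odd of good reduction with `a_p = 0` and the
cyclotomic `ℤ_p`-extension `κ`: if `Sel₀(ℚ_∞, E[p^∞])[p]` is finite (Conjecture A at the pair) then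
`Sel⁺(E/ℚ_∞)[p]` or `Sel⁻(E/ℚ_∞)[p]` is finite.  Residual corank count inside `Sel_{p^∞}(E/ℚ_∞)`:
`r(Sel⁺[p]) + r(Sel⁻[p]) ≤ r(Sel[p]) + r((Sel⁺ ∩ Sel⁻)[p]) ≤ 1 + 0`. Binders: the two Kurihara–Pollack statements
and Matar/Wingberg. [cite: KuriharaPollack2007, §1.2, §3 p. 328] [cite: Matar2020, Thm. 1.1]
[cite: Kobayashi2003, Def. 1.1, Thm. 7.3] -/
theorem finite_signed_pTorsion_or (hKP : Literature.NumberTheory.EllipticCurves.kuriharaPollack2007_selmerDual_extension_of_fineDual)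
    (hKo : Literature.NumberTheory.EllipticCurves.signedSelmerInf_sub_fineSelmer_of_loc)
    (hMa : matar2020_thm11_selmerDualTorsion_pseudoIso_fineSelmerDual)
    (W : WeierstrassCurve ℚ) [W.IsElliptic] [W.IsGloballyMinimal] (hp : p ≠ 2)
    (hgood : W.HasGoodReductionAtPrime p) (hap : W.frobeniusTrace p = 0) (κ : ZpExtension ℚ p) (hκ : κ.IsCyclotomic)
    (hF : Set.Finite {s : W.fineSelmerInfty κ | p • s = 0}) :
    Set.Finite {s : signedSelmerInfty W κ 1 | p • s = 0} ∨ Set.Finite {s : signedSelmerInfty W κ (-1) | p • s = 0} := by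
  obtain ⟨γ, hγ⟩ : ∃ γ : Field.absoluteGaloisGroup ℚ, κ.IsTopGenerator γ := κ.surjective (Multiplicative.ofAdd 1)
  let 𝔭 : PrimeSpectrum (IwasawaAlgebra p) := ⟨augIdealP p, isPrime_augIdealP_holds p⟩
  have h𝔭 : 𝔭.asIdeal = augIdealP p := rfl
  -- the three dual pairs
  let S := W.selmerDualData κ hγ
  let Dp := signedSelmerDualData W κ 1 hγ
  let Dm := signedSelmerDualData W κ (-1) hγ
  haveI : Module.Finite (IwasawaAlgebra p) Dp.X := Dp.moduleFinite hγ
  haveI : Module.Finite (IwasawaAlgebra p) Dm.X := Dm.moduleFinite hγ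
  -- h1: residual corank of `Sel` at most one
  have h1 : lengthAt (IwasawaAlgebra p) (S.X ⧸ (augIdealP p • (⊤ : Submodule (IwasawaAlgebra p) S.X))) 𝔭 ≤ 1 := by
    let Y := W.fineSelmerDualData κ hγ
    obtain ⟨v, ι, π, hv, hι, hπ, hex⟩ := hKP W p κ γ hp hgood hap hκ hγ S Y
    haveI : Finite (Y.X ⧸ (augIdealP p • (⊤ : Submodule (IwasawaAlgebra p) Y.X))) :=
      Y.finite_quotient_augIdealP_of_finite_pTorsion hF
    exact lengthAt_quot_le_one_of_extension 𝔭 h𝔭 v hv ι π hι hπ hex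
      (lengthAt_torsion_selmerDual_eq_zero hMa hp hgood hap hκ hγ S hF 𝔭 h𝔭)
      (lengthAt_eq_zero_of_finite' _ 𝔭 h𝔭)
  -- h2: `(Sel⁺ ∩ Sel⁻)[p]` is finite
  let φp : ↥(signedSelmerInfty W κ 1) →+ ↥(W.selmerInfty κ) := AddSubgroup.inclusion (signedSelmerInfty_le_selmerInfty W κ 1)
  let φm : ↥(signedSelmerInfty W κ (-1)) →+ ↥(W.selmerInfty κ) :=
    AddSubgroup.inclusion (signedSelmerInfty_le_selmerInfty W κ (-1))
  have h2 : Set.Finite {s : ↥(W.selmerInfty κ) | s ∈ φp.range ⊓ φm.range ∧ p • s = 0} := by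
    obtain ⟨j, hj⟩ := hKo W p κ hp hgood hap hκ
    -- the `p`-torsion subgroup `Cp` of `Sel⁺ ∩ Sel⁻` is finite: `ker (j|Cp) ↪ Sel₀[p]`, `im ⊆ (ℚ/ℤ)[p]`
    let C : AddSubgroup (W.subgroupH1 p κ.kerSubgroup) := signedSelmerInfty W κ 1 ⊓ signedSelmerInfty W κ (-1)
    let Cp : AddSubgroup C := (DistribSMul.toAddMonoidHom C p).ker
    let Tp : AddSubgroup (AddCircle (1 : ℚ)) := (DistribSMul.toAddMonoidHom (AddCircle (1 : ℚ)) p).ker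
    haveI : Finite Tp := (AddCircle.finite_torsion (1 : ℚ) (Fact.out : p.Prime).pos).to_subtype
    let j' : Cp →+ Tp := (j.comp Cp.subtype).codRestrict Tp fun c ↦ by
      change p • j c.1 = 0
      rw [← map_nsmul]
      have : p • (c.1 : C) = 0 := c.2
      rw [this, map_zero]
    haveI : Finite {s : W.fineSelmerInfty κ | p • s = 0} := hF.to_subtype
    haveI : Finite j'.ker := by
      refine Finite.of_injective (fun c : j'.ker ↦ (⟨⟨(c.1.1 : W.subgroupH1 p κ.kerSubgroup),
        hj c.1.1 (congrArg Subtype.val c.2)⟩, ?_⟩ : {s : W.fineSelmerInfty κ | p • s = 0})) ?_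
      · apply Subtype.ext
        change p • ((c.1.1 : C) : W.subgroupH1 p κ.kerSubgroup) = 0
        rw [← AddSubgroupClass.coe_nsmul, show p • (c.1.1 : C) = 0 from c.1.2]; rfl
      · intro c c' h
        apply Subtype.ext; apply Subtype.ext; apply Subtype.ext
        exact congrArg (fun s : {s : W.fineSelmerInfty κ | p • s = 0} ↦ ((s.1 : W.fineSelmerInfty κ) : W.subgroupH1 p κ.kerSubgroup)) h
    haveI : Finite Cp := by
      rw [finite_iff_addSubgroup_quotient j'.ker]
      exact ⟨inferInstance, Finite.of_equiv _ (QuotientAddGroup.quotientKerEquivRange j').symm.toEquiv⟩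
    refine Set.Finite.of_finite_image (f := fun s : ↥(W.selmerInfty κ) ↦ (s : W.subgroupH1 p κ.kerSubgroup)) ?_ ?_
    · refine (Set.finite_range (fun c : Cp ↦ ((c.1 : C) : W.subgroupH1 p κ.kerSubgroup))).subset ?_
      rintro _ ⟨s, ⟨⟨⟨a, ha⟩, ⟨b, hb⟩⟩, hps⟩, rfl⟩
      refine ⟨⟨⟨(s : W.subgroupH1 p κ.kerSubgroup), ?_, ?_⟩, ?_⟩, rfl⟩
      · rw [← ha]; exact a.2
      · rw [← hb]; exact b.2
      · apply Subtype.ext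
        change p • (s : W.subgroupH1 p κ.kerSubgroup) = 0
        rw [← AddSubgroupClass.coe_nsmul, hps]; rfl
    · exact Set.injOn_of_injective Subtype.val_injective
  -- the dichotomy
  have hdich := lengthAt_eq_zero_or_of_residual (WeierstrassCurve.SelmerDualData.isDualPair W S hγ)
    (Dp.isDualPair hγ) (Dm.isDualPair hγ)
    φp (fun a ↦ inclusion_signed_conj_sub_one W κ 1 γ a) (AddSubgroup.inclusion_injective _)
    φm (fun b ↦ inclusion_signed_conj_sub_one W κ (-1) γ b) (AddSubgroup.inclusion_injective _) 𝔭 h𝔭 h1 h2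
  -- `ℓ_{(p)}(X^ε) = 0` ⟹ `X^ε` finitely generated over `ℤ_p` ⟹ `Sel^ε[p]` finite
  rcases hdich with h | h
  · exact Or.inl (finite_pTorsion_of_lengthAt_eq_zero (Dp.isDualPair hγ) 𝔭 h𝔭 h)
  · exact Or.inr (finite_pTorsion_of_lengthAt_eq_zero (Dm.isDualPair hγ) 𝔭 h𝔭 h)

end Lever

end Summit.BirchSwinnertonDyer.BirchSwinnertonDyer.Theorems.SmallImageFinePivot

end
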